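import Mathlib.Data.Fintype.Pi
import Mathlib.Data.Finset.Card
import Mathlib.Data.Fin.Tuple.Basic
import Mathlib.Algebra.BigOperators.Ring.Finset
import Mathlib.Algebra.Order.BigOperators.Group.Finset
import Mathlib.Tactic.Linarith
import Mathlib.Tactic.Ring
import Summits.CriticalPhenomena.PercolationContinuityZ3.Theorems.SahiMasterFamilyFCombShiftDefs
import Summits.CriticalPhenomena.PercolationContinuityZ3.Theorems.SahiMasterFamilyFCombReadOnce
import HarnessLib

/-!
# Down-shifts of families of cube points: membership, monotonicity, cardinality, sections

Support file (cell `prim-bnk`, seat bnk-2 gen 21; `--supports stmt-CriticalPhenomena-4575`; complete write-up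
`run/shared/lean/prim/prim-l12/PROOF-F-inequality.md`).  No definition, no `sorry`, standard axioms.  Part of the proof of the comb
inequality `K(A,B,G) ≥ 0` for ALL monotone third events `G`, hence of the master-family inequality
`(1+μG)μ(A∩B∩G) ≥ μG·μ(A∩B) + μ(A∩G)μ(B∩G)` for all increasing `A,B,G` and every product measure (`…FCombAllThirdEvents`).

THIS FILE: the elementary down-shift `dn i` (`…ShiftDefs`) is monotone in the family (L1), stays inside families closed under lowering a
coordinate (L2), preserves cardinality (L4, via the fibres of `x ↦ update x i false`), and interacts with the sections along a coordinate
`c` as follows: the `false`-section of `dn c X` is the union and the `true`-section the intersection of the two sections of `X`, while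
down-shifts along the other coordinates commute with taking sections. [this work; all statements folklore]
-/

namespace Summit.CriticalPhenomena.PercolationContinuityZ3.Theorems

namespace SahiFComb

open Finset

variable {n : ℕ}

/-! ### 1. The elementary down-shift -/

/-- Membership in an elementary down-shift. [folklore] -/
theorem mem_dn {i : Fin n} {X : Finset (Fin n → Bool)} {x : Fin n → Bool} :
    x ∈ dn i X ↔ (x i = false ∧ (x ∈ X ∨ Function.update x i true ∈ X)) ∨
      (x i = true ∧ x ∈ X ∧ Function.update x i false ∈ X) := by
  simp [dn]

/-- The empty shift sequence does nothing. [folklore] -/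
theorem dnSeq_nil (X : Finset (Fin n → Bool)) : dnSeq [] X = X := rfl

/-- Unfolding one step of an iterated down-shift (head first). [folklore] -/
theorem dnSeq_cons (i : Fin n) (s : List (Fin n)) (X : Finset (Fin n → Bool)) :
    dnSeq (i :: s) X = dnSeq s (dn i X) := rfl

/-- `update x i b` then `update _ i b'` is `update x i b'`. -/
theorem update_update_same' (x : Fin n → Bool) (i : Fin n) (b b' : Bool) :
    Function.update (Function.update x i b) i b' = Function.update x i b' := by
  simp

/-- Updating a coordinate to its current value does nothing. [folklore] -/
theorem update_eq_self_of_eq (x : Fin n → Bool) (i : Fin n) (b : Bool) (h : x i = b) :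
    Function.update x i b = x := by
  rw [← h, Function.update_eq_self]

/-- Monotonicity of the down-shift in the family (L1). -/
theorem dn_mono {i : Fin n} {X Y : Finset (Fin n → Bool)} (h : X ⊆ Y) : dn i X ⊆ dn i Y := by
  intro x hx
  rw [mem_dn] at hx ⊢
  rcases hx with ⟨hi, hx | hx⟩ | ⟨hi, hx1, hx2⟩
  · exact Or.inl ⟨hi, Or.inl (h hx)⟩
  · exact Or.inl ⟨hi, Or.inr (h hx)⟩
  · exact Or.inr ⟨hi, h hx1, h hx2⟩

/-- Iterated down-shifts are monotone in the family (L1). [folklore] -/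
theorem dnSeq_mono (s : List (Fin n)) {X Y : Finset (Fin n → Bool)} (h : X ⊆ Y) : dnSeq s X ⊆ dnSeq s Y := by
  induction s generalizing X Y with
  | nil => exact h
  | cons i s ih => exact ih (dn_mono h)

/-- Containment (L2): a down-shift of a subfamily of a family closed under lowering single coordinates stays inside it. -/
theorem dn_subset_of_lower {i : Fin n} {X S : Finset (Fin n → Bool)} (hXS : X ⊆ S)
    (hS : ∀ x ∈ S, ∀ j, Function.update x j false ∈ S) : dn i X ⊆ S := by
  intro x hx
  rw [mem_dn] at hx
  rcases hx with ⟨hi, hx | hx⟩ | ⟨_, hx1, _⟩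
  · exact hXS hx
  · have h2 := hS _ (hXS hx) i
    rw [update_update_same', update_eq_self_of_eq x i false hi] at h2
    exact h2
  · exact hXS hx1

/-- Iterated down-shifts stay inside a family closed under lowering coordinates (L2). [folklore] -/
theorem dnSeq_subset_of_lower (s : List (Fin n)) {X S : Finset (Fin n → Bool)} (hXS : X ⊆ S)
    (hS : ∀ x ∈ S, ∀ j, Function.update x j false ∈ S) : dnSeq s X ⊆ S := by
  induction s generalizing X with
  | nil => exact hXS
  | cons i s ih => exact ih (dn_subset_of_lower hXS hS)

/-! ### 2. Fibres along a coordinate and the cardinality of a down-shift -/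

/-- The points projecting to a given lower point `y` (`y i = false`) are `y` and `update y i true`. -/
theorem update_false_eq_iff {i : Fin n} {x y : Fin n → Bool} (hy : y i = false) :
    Function.update x i false = y ↔ (x = y ∨ x = Function.update y i true) := by
  constructor
  · intro h
    by_cases hxi : x i = true
    · right
      rw [← h, update_update_same', update_eq_self_of_eq x i true hxi]
    · left
      have hxi' : x i = false := by simpa using hxi
      rw [← h, update_eq_self_of_eq x i false hxi']
  · rintro (rfl | rfl)
    · exact update_eq_self_of_eq x i false hy
    · rw [update_update_same', update_eq_self_of_eq y i false hy]

/-- A fibre of the projection `x ↦ update x i false` has `[y ∈ X] + [update y i true ∈ X]` points of `X`. [folklore] -/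
theorem card_fiber {i : Fin n} (X : Finset (Fin n → Bool)) {y : Fin n → Bool} (hy : y i = false) :
    (X.filter (fun x => Function.update x i false = y)).card =
      (if y ∈ X then 1 else 0) + (if Function.update y i true ∈ X then 1 else 0) := by
  have hne : y ≠ Function.update y i true := by
    intro h
    have := congrFun h i
    simp [hy] at this
  have hset : X.filter (fun x => Function.update x i false = y) =
      ({y, Function.update y i true} : Finset (Fin n → Bool)).filter (fun x => x ∈ X) := by
    ext x
    simp only [Finset.mem_filter, Finset.mem_insert, Finset.mem_singleton]
    rw [update_false_eq_iff hy]
    tauto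
  rw [hset, Finset.filter_insert, Finset.filter_singleton]
  by_cases h1 : y ∈ X <;> by_cases h2 : Function.update y i true ∈ X <;> simp [h1, h2, hne]

/-- Cardinality as a sum over the fibres of `x ↦ update x i false`. [folklore] -/
theorem card_eq_sum_fiber (i : Fin n) (X : Finset (Fin n → Bool)) :
    X.card = ∑ y ∈ Finset.univ.filter (fun y : Fin n → Bool => y i = false),
      (X.filter (fun x => Function.update x i false = y)).card := by
  apply Finset.card_eq_sum_card_fiberwise
  intro x _
  simp

/-- A down-shift preserves cardinality (L4). -/
theorem card_dn (i : Fin n) (X : Finset (Fin n → Bool)) : (dn i X).card = X.card := by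
  rw [card_eq_sum_fiber i (dn i X), card_eq_sum_fiber i X]
  refine Finset.sum_congr rfl (fun y hy => ?_)
  have hy' : y i = false := by simpa using hy
  rw [card_fiber _ hy', card_fiber _ hy']
  have hup : Function.update (Function.update y i true) i false = y := by
    rw [update_update_same', update_eq_self_of_eq y i false hy']
  have hupt : (Function.update y i true) i = true := by simp
  have m1 : y ∈ dn i X ↔ (y ∈ X ∨ Function.update y i true ∈ X) := by
    rw [mem_dn]; simp [hy']
  have m2 : Function.update y i true ∈ dn i X ↔ (Function.update y i true ∈ X ∧ y ∈ X) := by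
    rw [mem_dn]
    simp only [hupt, hup]
    simp
  by_cases h1 : y ∈ X <;> by_cases h2 : Function.update y i true ∈ X <;> simp [m1, m2, h1, h2]

/-- Iterated down-shifts preserve cardinality (L4). [folklore] -/
theorem card_dnSeq (s : List (Fin n)) (X : Finset (Fin n → Bool)) : (dnSeq s X).card = X.card := by
  induction s generalizing X with
  | nil => rfl
  | cons i s ih => rw [dnSeq_cons, ih, card_dn]


/-! ### 3. Sections along a coordinate -/

/-- Membership in a section. [folklore] -/
theorem mem_sec {c : Fin (n + 1)} {t : Bool} {X : Finset (Fin (n + 1) → Bool)} {y : Fin n → Bool} :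
    y ∈ sec c t X ↔ Fin.insertNth c t y ∈ X := by
  simp [sec]

/-- Updating another coordinate of an inserted tuple. [folklore] -/
theorem update_insertNth_succAbove (c : Fin (n + 1)) (t : Bool) (y : Fin n → Bool) (j : Fin n) (b : Bool) :
    Function.update (Fin.insertNth (α := fun _ => Bool) c t y) (c.succAbove j) b =
      Fin.insertNth (α := fun _ => Bool) c t (Function.update y j b) := by
  funext k
  refine Fin.succAboveCases c ?_ (fun j' => ?_) k
  · rw [Function.update_of_ne (Fin.succAbove_ne c j).symm]
    simp [Fin.insertNth_apply_same]
  · by_cases h : j' = j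
    · subst h
      simp [Fin.insertNth_apply_succAbove]
    · have hne : c.succAbove j' ≠ c.succAbove j := fun h' => h (Fin.succAbove_right_injective h')
      rw [Function.update_of_ne hne]
      simp [Fin.insertNth_apply_succAbove, Function.update_of_ne h]

/-- Value of an inserted tuple at the inserted coordinate (Bool-valued form). [folklore] -/
theorem insertNth_apply_same' (c : Fin (n + 1)) (t : Bool) (y : Fin n → Bool) :
    Fin.insertNth (α := fun _ => Bool) c t y c = t := by
  simp [Fin.insertNth_apply_same]

/-- Value of an inserted tuple away from the inserted coordinate (Bool-valued form). [folklore] -/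
theorem insertNth_apply_succAbove' (c : Fin (n + 1)) (t : Bool) (y : Fin n → Bool) (j : Fin n) :
    Fin.insertNth (α := fun _ => Bool) c t y (c.succAbove j) = y j := by
  simp [Fin.insertNth_apply_succAbove]

/-- The `false`-section of `dn c X` is the union of the two sections of `X`. -/
theorem sec_false_dn_self (c : Fin (n + 1)) (X : Finset (Fin (n + 1) → Bool)) :
    sec c false (dn c X) = sec c false X ∪ sec c true X := by
  ext y
  rw [Finset.mem_union, mem_sec, mem_sec, mem_sec, mem_dn, insertNth_apply_same', update_insertNth,
    update_insertNth]
  simp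

/-- The `true`-section of `dn c X` is the intersection of the two sections of `X`. -/
theorem sec_true_dn_self (c : Fin (n + 1)) (X : Finset (Fin (n + 1) → Bool)) :
    sec c true (dn c X) = sec c false X ∩ sec c true X := by
  ext y
  rw [Finset.mem_inter, mem_sec, mem_sec, mem_sec, mem_dn, insertNth_apply_same', update_insertNth,
    update_insertNth]
  simp [and_comm]

/-- Down-shifts along the other coordinates commute with taking sections. -/
theorem sec_dn_succAbove (c : Fin (n + 1)) (t : Bool) (j : Fin n) (X : Finset (Fin (n + 1) → Bool)) :
    sec c t (dn (c.succAbove j) X) = dn j (sec c t X) := by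
  ext y
  rw [mem_sec, mem_dn, mem_dn, mem_sec, mem_sec, mem_sec, insertNth_apply_succAbove', update_insertNth_succAbove,
    update_insertNth_succAbove]

/-- Iterated down-shifts along the other coordinates commute with sections. [folklore] -/
theorem sec_dnSeq_map (c : Fin (n + 1)) (t : Bool) (s : List (Fin n)) (X : Finset (Fin (n + 1) → Bool)) :
    sec c t (dnSeq (s.map c.succAbove) X) = dnSeq s (sec c t X) := by
  induction s generalizing X with
  | nil => rfl
  | cons j s ih => rw [List.map_cons, dnSeq_cons, dnSeq_cons, ih, sec_dn_succAbove]

/-- A point of the `(n+1)`-cube is `insertNth c (x c) (its c-section)`. -/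
theorem eq_insertNth (c : Fin (n + 1)) (x : Fin (n + 1) → Bool) :
    x = Fin.insertNth (α := fun _ => Bool) c (x c) (fun j => x (c.succAbove j)) := by
  funext k
  refine Fin.succAboveCases c ?_ (fun j => ?_) k
  · simp [Fin.insertNth_apply_same]
  · simp [Fin.insertNth_apply_succAbove]


/-! ### 3b. Counting the two sections of a family -/

/-- The points with prescribed value at `c` are the inserted section. [folklore] -/
theorem filter_coord_eq_image_sec (c : Fin (n + 1)) (t : Bool) (X : Finset (Fin (n + 1) → Bool)) :
    X.filter (fun x => x c = t) = (sec c t X).image (Fin.insertNth (α := fun _ => Bool) c t) := by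
  ext x
  rw [Finset.mem_filter, Finset.mem_image]
  constructor
  · rintro ⟨hx, hc⟩
    refine ⟨fun j => x (c.succAbove j), ?_, ?_⟩
    · rw [mem_sec, ← hc, ← eq_insertNth]; exact hx
    · rw [← hc, ← eq_insertNth]
  · rintro ⟨y, hy, rfl⟩
    exact ⟨mem_sec.mp hy, insertNth_apply_same' c t y⟩

/-- A section has as many points as the corresponding coordinate slice. [folklore] -/
theorem card_sec_eq (c : Fin (n + 1)) (t : Bool) (X : Finset (Fin (n + 1) → Bool)) :
    (sec c t X).card = (X.filter (fun x => x c = t)).card := by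
  rw [filter_coord_eq_image_sec, Finset.card_image_of_injective _ (Fin.insertNth_right_injective _)]

/-- The two sections of a family partition it. -/
theorem card_sec_add (c : Fin (n + 1)) (X : Finset (Fin (n + 1) → Bool)) :
    (sec c false X).card + (sec c true X).card = X.card := by
  rw [card_sec_eq, card_sec_eq]
  have h := Finset.card_filter_add_card_filter_not (s := X) (fun x : Fin (n + 1) → Bool => x c = false)
  have h2 : X.filter (fun x => ¬ x c = false) = X.filter (fun x => x c = true) :=
    Finset.filter_congr (fun x _ => by simp)
  rw [h2] at h
  exact h

end SahiFComb

end Summit.CriticalPhenomena.PercolationContinuityZ3.Theorems
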